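import Summits.CriticalPhenomena.PercolationContinuityZ3.Theorems.SahiIsingExtremalStates

/-!
# Unconditionally, every order: functions of three spins under box-TP₂ spin laws and the infinite-volume Ising states

Support file of the Sahi cell (`prim-sahi`, typer seat, generation 13; `--supports stmt-CriticalPhenomena-4575`).
Theorems only (no definitions, no named facts, no sorries).  Sixth file of the generation-13 Ising series.

Typer generation 4 proved Sahi's `C_n` for EVERY `n` and EVERY FKG probability weight on `{−1,+1}³`
(`SahiThreeCoordinates.sahiPositive_spinCube_three`, from P1's `sahiPositive_cube_three`) and transferred it along
lattice homomorphisms (`Literature.Combinatorics.Sahi2008.Marginals.sahiE_comp_nonneg_of_forall_isFKGMeasure`,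
Karlin–Rinott's marginal proposition), obtaining the finite-volume Ising statement `ising_sahiE_threeSites_nonneg`.
With generation 13's `isFKGMeasure_map_restrict` (window marginals of box-TP₂ spin laws are FKG weights) the same
transfer runs in infinite volume:

* `msahiE_comp_latticeHom_nonneg_of_isBoxTP2` — for a box-TP₂ probability measure `μ` on `{−1,+1}^ι`, a finite
  window `J`, a lattice homomorphism `H : {−1,+1}^J → γ` into a finite lattice on which EVERY FKG weight is
  Sahi-positive of order `n`, and nonnegative monotone `g_i : γ → ℝ`: `0 ≤ E_n(g_0(H σ|_J), …, g_{n−1}(H σ|_J))`.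
* `msahiE_threeSites_nonneg_of_isBoxTP2` — **for any three sites `v₀, v₁, v₂` (repetitions allowed), EVERY `n`
  and all nonnegative functions `g_0,…,g_{n−1}` of `(σ_{v₀}, σ_{v₁}, σ_{v₂})` nondecreasing in each spin:
  `E_n ≥ 0` under every box-TP₂ spin law — UNCONDITIONALLY.**
* The Ising states on `ℤ^d`: `plusState_msahiE_threeSites_nonneg`, `minusState_…` (`β ≥ 0`, any `h`),
  `freeState_…` (`h ≥ 0`), `msahiE_threeSites_nonneg_of_isTailTrivial` (every extremal state).

No sorries, no new axioms.
-/

noncomputable section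

namespace Summit.CriticalPhenomena.PercolationContinuityZ3.Theorems.SahiBoxTP2

open MeasureTheory ProbabilityTheory Set Filter Topology Function Literature.Combinatorics.Sahi2008
open Literature.Probability.LatticeModels
open scoped ENNReal

/-! ### Transfer along lattice homomorphisms of a window -/

section Transfer

variable {ι : Type*} [Countable ι] [DecidableEq ι] {n : ℕ}

/-- **`E_n ≥ 0` for families factoring through a lattice homomorphism of a finite window into a settled lattice**:
`μ` box-TP₂ on `{−1,+1}^ι`, `H : {−1,+1}^J → γ` a lattice homomorphism, every FKG probability weight on `γ`
Sahi-positive of order `n`, `g_i` nonnegative monotone on `γ`. [this work] -/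
theorem msahiE_comp_latticeHom_nonneg_of_isBoxTP2 {γ : Type*} [Fintype γ] [Lattice γ] (μ : Measure (ι → ℤˣ))
    [IsProbabilityMeasure μ] (hμ : IsBoxTP2 μ) (J : Finset ι) (H : LatticeHom (↥J → ℤˣ) γ)
    (hγ : ∀ ν : γ → ℝ, IsFKGMeasure ν → SahiPositive ν n) (g : Fin n → γ → ℝ) (hg0 : ∀ i c, 0 ≤ g i c)
    (hmono : ∀ i, Monotone (g i)) : 0 ≤ msahiE μ n fun i σ => g i (H (J.restrict σ)) := by
  set r : (ι → ℤˣ) → (↥J → ℤˣ) := fun σ => J.restrict σ with hr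
  haveI : IsProbabilityMeasure (μ.map r) :=
    Measure.isProbabilityMeasure_map (measurable_finsetRestrict J).aemeasurable
  have hmp : MeasurePreserving r μ (μ.map r) := ⟨measurable_finsetRestrict J, rfl⟩
  have key : 0 ≤ msahiE (μ.map r) n fun i => g i ∘ H := by
    rw [SahiFKGBondMeasures.msahiE_eq_sahiE_real_singleton]
    exact sahiE_comp_nonneg_of_forall_isFKGMeasure (isFKGMeasure_map_restrict μ hμ J) H hγ g hg0 hmono
  rwa [← msahiE_comp_measurePreserving_of_measurable hmp n _ fun i => measurable_of_countable _] at key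

/-- **THREE SITES, EVERY ORDER, UNCONDITIONALLY**: for a box-TP₂ probability measure `μ` on `{−1,+1}^ι`, sites
`v₀, v₁, v₂ : ι` (repetitions allowed), every `n` and nonnegative `g_0,…,g_{n−1} : {−1,+1}³ → ℝ` nondecreasing in
each spin: `0 ≤ E_n(g_0(σ_v), …, g_{n−1}(σ_v))`.  (Every FKG weight on `{−1,+1}³` is Sahi-positive of every order:
`SahiThreeCoordinates.sahiPositive_spinCube_three`.) [this work] -/
theorem msahiE_threeSites_nonneg_of_isBoxTP2 (μ : Measure (ι → ℤˣ)) [IsProbabilityMeasure μ] (hμ : IsBoxTP2 μ)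
    (v : Fin 3 → ι) (g : Fin n → (Fin 3 → ℤˣ) → ℝ) (hg0 : ∀ i y, 0 ≤ g i y) (hmono : ∀ i, Monotone (g i)) :
    0 ≤ msahiE μ n fun i σ => g i fun a => σ (v a) := by
  set J : Finset ι := Finset.univ.image v with hJ
  have hv : ∀ a, v a ∈ J := fun a => Finset.mem_image_of_mem v (Finset.mem_univ a)
  set H : LatticeHom (↥J → ℤˣ) (Fin 3 → ℤˣ) :=
    { toFun := fun x a => x ⟨v a, hv a⟩
      map_sup' := fun x y => by funext a; simp only [Pi.sup_apply]
      map_inf' := fun x y => by funext a; simp only [Pi.inf_apply] } with hH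
  exact msahiE_comp_latticeHom_nonneg_of_isBoxTP2 μ hμ J H
    (fun _ hν => SahiThreeCoordinates.sahiPositive_spinCube_three hν n) g hg0 hmono

end Transfer

/-! ### The infinite-volume Ising states on `ℤ^d` -/

section Ising

variable {d : ℕ} {β h : ℝ} {n : ℕ}

/-- **PLUS STATE, three sites, every order, unconditionally** (`β ≥ 0`, any `h`): for any three sites of `ℤ^d` and
nonnegative `g_i` of the three spins, nondecreasing in each spin, `0 ≤ E_n(g_0(σ_v),…,g_{n−1}(σ_v))` under every
probability measure with the plus correlations. [this work] -/
theorem plusState_msahiE_threeSites_nonneg (hβ : 0 ≤ β) (μ : Measure (SpinConfig (Site d)))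
    [IsProbabilityMeasure μ] (hμ : ∀ B : Finset (Site d), spinCorr μ B = plusCorr d β h B) (v : Fin 3 → Site d)
    (g : Fin n → (Fin 3 → ℤˣ) → ℝ) (hg0 : ∀ i y, 0 ≤ g i y) (hmono : ∀ i, Monotone (g i)) :
    0 ≤ msahiE μ n fun i σ => g i fun a => σ (v a) :=
  msahiE_threeSites_nonneg_of_isBoxTP2 μ (isBoxTP2_of_forall_spinCorr_eq_plusCorr hβ μ hμ) v g hg0 hmono

/-- MINUS STATE, three sites, every order (`β ≥ 0`, any `h`). [this work] -/
theorem minusState_msahiE_threeSites_nonneg (hβ : 0 ≤ β) (μ : Measure (SpinConfig (Site d)))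
    [IsProbabilityMeasure μ] (hμ : ∀ B : Finset (Site d), spinCorr μ B = minusCorr d β h B) (v : Fin 3 → Site d)
    (g : Fin n → (Fin 3 → ℤˣ) → ℝ) (hg0 : ∀ i y, 0 ≤ g i y) (hmono : ∀ i, Monotone (g i)) :
    0 ≤ msahiE μ n fun i σ => g i fun a => σ (v a) :=
  msahiE_threeSites_nonneg_of_isBoxTP2 μ (isBoxTP2_of_forall_spinCorr_eq_minusCorr hβ μ hμ) v g hg0 hmono

/-- FREE STATE (`h ≥ 0`), three sites, every order. [this work] -/
theorem freeState_msahiE_threeSites_nonneg (hβ : 0 ≤ β) (hh : 0 ≤ h) (μ : Measure (SpinConfig (Site d)))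
    [IsProbabilityMeasure μ] (hμ : ∀ B : Finset (Site d), spinCorr μ B = freeCorr d β h B) (v : Fin 3 → Site d)
    (g : Fin n → (Fin 3 → ℤˣ) → ℝ) (hg0 : ∀ i y, 0 ≤ g i y) (hmono : ∀ i, Monotone (g i)) :
    0 ≤ msahiE μ n fun i σ => g i fun a => σ (v a) :=
  msahiE_threeSites_nonneg_of_isBoxTP2 μ (isBoxTP2_of_forall_spinCorr_eq_freeCorr hβ hh μ hμ) v g hg0 hmono

/-- EVERY TAIL-TRIVIAL (extremal) Ising Gibbs state, three sites, every order (`β ≥ 0`, any `h`). [this work] -/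
theorem msahiE_threeSites_nonneg_of_isTailTrivial (hβ : 0 ≤ β) {μ : Measure (SpinConfig (Site d))}
    (hμ : μ ∈ isingGibbsMeasures d β h) (hμt : IsTailTrivial μ) (v : Fin 3 → Site d)
    (g : Fin n → (Fin 3 → ℤˣ) → ℝ) (hg0 : ∀ i y, 0 ≤ g i y) (hmono : ∀ i, Monotone (g i)) :
    0 ≤ msahiE μ n fun i σ => g i fun a => σ (v a) := by
  have hμG : IsGibbsMeasure (isingSpecification (zdGraph d) β h) μ := hμ
  haveI := hμG.isProbabilityMeasure
  exact msahiE_threeSites_nonneg_of_isBoxTP2 μ (isBoxTP2_of_isTailTrivial hβ hμ hμt) v g hg0 hmono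

end Ising

end Summit.CriticalPhenomena.PercolationContinuityZ3.Theorems.SahiBoxTP2
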